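import Mathlib
import Summits.Ventures.PercRepro2.CoinChainCover
import Summits.Ventures.PercRepro2.CoinK2HeadBlindVals
import Summits.Ventures.PercRepro2.CoinChainAWorldLemmas

/-!
# The pure AND-switch chain as a coin system — the reduction to the chain functional
(blind cell PercRepro2, night-2 g19; proofs/NIGHT2-DARC.md §59.8)

The pure chain: an OR-vertex `a'` entered from `ent' ⊆ U` by SURE coins (`h'`, `hsure'`), the
free-arc vertex `a` entered from `a'` alone by one random coin (`h`, entry set `{a'}`), markers
anywhere in `U`, any head.  After the two level reductions of §57 the `R`-law and gate on `U`
are exactly `ν · chainMix ∅ ent' ρ (chainC) (chainD)` and `ν · chainMix ∅ ent' ρ (chainC) (chainD')`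
with `ρ = pr (c a')`, `chainC = A ∘ chainPhi`, `chainD = A (chainPhi · ∪ {a})`,
`chainD' = A (chainPhi · ∪ {a, w})`, `chainPhi W = W ∪ {a'}[W meets ent']`, `A X = P(X avoids t)`
(`rValK_sure_chain_eq`, `gValK_sure_chain_eq`).  So row 2′DARC at the pure chain follows from
the nonnegativity of that chain functional (`pureChain_darc_of_functional`); the standard head
hypotheses of the chain theorems hold for these data (`chainPhi_head_hyps`).  The corollaries
of the conditional theorems are in `CoinChainAWorldDarc.lean`.
-/

namespace Summit.Ventures.PercRepro2.Coin

section ChainReduction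

variable {V : Type*} {E : Type*} [Fintype V] [DecidableEq V] [Fintype E] [DecidableEq E]
  {R : Type*} [Field R] [LinearOrder R] [IsStrictOrderedRing R]
  {arcs : E → Finset (V × V)} {s : V} {U : Finset V} {ent' : Finset V} {c' : V → E} {a' a w : V}
  {c : V → E}

/-- The `a'`-closure of a cluster: `W ∪ {a'}` if `W` meets `ent'`, else `W`. -/
def chainPhi (ent' : Finset V) (a' : V) (W : Finset V) : Finset V :=
  if ∃ r ∈ ent', r ∈ W then W ∪ {a'} else W

/-- The closure value `c` of the pure chain: `A (chainPhi W)`, `A X = P(X avoids t)`. -/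
noncomputable def chainC (pr : E → R) (arcs : E → Finset (V × V)) (s t : V) (U ent' : Finset V) (a' a : V)
    (X : Finset V) : R :=
  prob pr (coreAvoidEvent arcs s t (insert a (insert a' U)) (chainPhi ent' a' X))

/-- The value `d = c(· + a)` of the pure chain. -/
noncomputable def chainD (pr : E → R) (arcs : E → Finset (V × V)) (s t : V) (U ent' : Finset V) (a' a : V)
    (X : Finset V) : R :=
  prob pr (coreAvoidEvent arcs s t (insert a (insert a' U)) (chainPhi ent' a' X ∪ {a}))

/-- The value `d' = c(· + a + w)` of the pure chain. -/
noncomputable def chainD' (pr : E → R) (arcs : E → Finset (V × V)) (s t : V) (U ent' : Finset V) (a' a w : V)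
    (X : Finset V) : R :=
  prob pr (coreAvoidEvent arcs s t (insert a (insert a' U)) (chainPhi ent' a' X ∪ {a, w}))

omit [Fintype V] [Fintype E] [DecidableEq E] [LinearOrder R] [IsStrictOrderedRing R] in
/-- `tailWtK` for the one-entry set `{a'}`: `1 − ρ·[a' ∈ X]`. -/
lemma tailWtK_singleton (pr : E → R) (c : V → E) (a' : V) (X : Finset V) :
    tailWtK pr {a'} c X = 1 - pr (c a') * (if a' ∈ X then 1 else 0) := by
  unfold tailWtK
  rw [Finset.prod_singleton]

omit [Fintype V] [Fintype E] [DecidableEq E] [LinearOrder R] [IsStrictOrderedRing R] in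
/-- With sure `a'`-coins, the nested `R`-value (in the expanded form produced by `sum_gen`) is
the chain mixture `chainMix ∅ ent' ρ c d` with `c = A ∘ chainPhi`, `d = A (chainPhi · ∪ {a})`. -/
lemma rValK_sure_chain_eq (A : Finset V → R) (pr : E → R) (hsure' : ∀ r ∈ ent', pr (c' r) = 1)
    (W : Finset V) (ha'W : a' ∉ W) :
    tailWtK pr ent' c' W * rValK A pr {a'} c a W +
      (1 - tailWtK pr ent' c' W) * rValK A pr {a'} c a (W ∪ {a'}) =
      chainMix ∅ ent' (pr (c a')) (fun X => A (chainPhi ent' a' X))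
        (fun X => A (chainPhi ent' a' X ∪ {a})) W := by
  unfold rValK chainMix chainPhi
  rw [tailWtK_sure pr c' hsure' W, chainTheta_empty, tailWtK_singleton, tailWtK_singleton]
  by_cases hW : ∃ r ∈ ent', r ∈ W
  · simp only [hW, if_true, if_false, ha'W, Finset.mem_union, Finset.mem_singleton, or_true]
    ring
  · simp only [hW, if_false, ha'W]
    ring

omit [Fintype V] [Fintype E] [DecidableEq E] [LinearOrder R] [IsStrictOrderedRing R] in
/-- With sure `a'`-coins, the nested gate value is the chain mixture with
`d' = A (chainPhi · ∪ {a, w})`. -/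
lemma gValK_sure_chain_eq (A : Finset V → R) (pr : E → R) (hsure' : ∀ r ∈ ent', pr (c' r) = 1)
    (W : Finset V) (ha'W : a' ∉ W) :
    tailWtK pr ent' c' W * gValK A pr {a'} c a w W +
      (1 - tailWtK pr ent' c' W) * gValK A pr {a'} c a w (W ∪ {a'}) =
      chainMix ∅ ent' (pr (c a')) (fun X => A (chainPhi ent' a' X))
        (fun X => A (chainPhi ent' a' X ∪ {a, w})) W := by
  unfold gValK chainMix chainPhi
  rw [tailWtK_sure pr c' hsure' W, chainTheta_empty, tailWtK_singleton, tailWtK_singleton]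
  by_cases hW : ∃ r ∈ ent', r ∈ W
  · simp only [hW, if_true, if_false, ha'W, Finset.mem_union, Finset.mem_singleton, or_true]
    ring
  · simp only [hW, if_false, ha'W]
    ring

omit [Fintype V] [Fintype E] [DecidableEq E] [LinearOrder R] [IsStrictOrderedRing R] in
/-- `(X ∪ Z) ∪ (Y ∪ Z) = (X ∪ Y) ∪ Z`. -/
lemma union_union_same (X Y Z : Finset V) : (X ∪ Z) ∪ (Y ∪ Z) = (X ∪ Y) ∪ Z := by
  ext v; simp only [Finset.mem_union]; tauto

omit [Fintype V] [Fintype E] [DecidableEq E] [LinearOrder R] [IsStrictOrderedRing R] in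
/-- `(X ∪ {a}) ∪ (Y ∪ {a, w}) = (X ∪ Y) ∪ {a, w}`. -/
lemma union_a_union_aw (X Y : Finset V) (a w : V) :
    (X ∪ {a}) ∪ (Y ∪ {a, w}) = (X ∪ Y) ∪ {a, w} := by
  ext v; simp only [Finset.mem_union, Finset.mem_singleton, Finset.mem_insert]; tauto

omit [Fintype V] [Fintype E] [DecidableEq E] [LinearOrder R] [IsStrictOrderedRing R] in
/-- `(X ∪ {a, w}) ∪ (Y ∪ {a}) = (X ∪ Y) ∪ {a, w}`. -/
lemma union_aw_union_a (X Y : Finset V) (a w : V) :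
    (X ∪ {a, w}) ∪ (Y ∪ {a}) = (X ∪ Y) ∪ {a, w} := by
  ext v; simp only [Finset.mem_union, Finset.mem_singleton, Finset.mem_insert]; tauto

omit [Fintype V] [IsStrictOrderedRing R] in
/-- **THE REDUCTION.**  Row 2′DARC at the pure chain follows from the nonnegativity of the
chain functional of the data `ν = P(level)`, `c = A ∘ chainPhi`, `d = A (chainPhi · ∪ {a})`,
`d' = A (chainPhi · ∪ {a, w})`, `ρ = pr (c a')`, with `A X = P(X avoids t)` (`hF`). -/
theorem pureChain_darc_of_functional (pr : E → R) (hS : SameEnds arcs)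
    (h' : OrTailK arcs s U ent' c' a') (hsure' : ∀ r ∈ ent', pr (c' r) = 1)
    (h : OrTailK arcs s (insert a' U) {a'} c a)
    {m₁ m₂ : V} (hm₁ : m₁ ∈ U) (hm₂ : m₂ ∈ U)
    {t : V} (htC : t ∉ insert a (insert a' U)) (hts : t ≠ s) (hws : w ≠ s)
    (hwC : w ∉ insert a (insert a' U))
    (hF : 0 ≤ (∑ W ∈ U.powerset, prob pr (coreLevel arcs s U W) *
            chainMix ∅ ent' (pr (c a')) (chainC pr arcs s t U ent' a' a) (chainD pr arcs s t U ent' a' a) W) ^ 2 *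
          (∑ W ∈ U.powerset, prob pr (coreLevel arcs s U W) *
            chainMix ∅ ent' (pr (c a')) (chainC pr arcs s t U ent' a' a) (chainD' pr arcs s t U ent' a' a w) W *
            ((if m₁ ∈ W then (1 : R) else 0) * (if m₂ ∈ W then (1 : R) else 0)))
        - (∑ W ∈ U.powerset, prob pr (coreLevel arcs s U W) *
            chainMix ∅ ent' (pr (c a')) (chainC pr arcs s t U ent' a' a) (chainD pr arcs s t U ent' a' a) W) *
          (∑ W ∈ U.powerset, prob pr (coreLevel arcs s U W) *
            chainMix ∅ ent' (pr (c a')) (chainC pr arcs s t U ent' a' a) (chainD pr arcs s t U ent' a' a) W *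
            (if m₁ ∈ W then (1 : R) else 0)) *
          (∑ W ∈ U.powerset, prob pr (coreLevel arcs s U W) *
            chainMix ∅ ent' (pr (c a')) (chainC pr arcs s t U ent' a' a) (chainD' pr arcs s t U ent' a' a w) W *
            (if m₂ ∈ W then (1 : R) else 0))
        - (∑ W ∈ U.powerset, prob pr (coreLevel arcs s U W) *
            chainMix ∅ ent' (pr (c a')) (chainC pr arcs s t U ent' a' a) (chainD pr arcs s t U ent' a' a) W) *
          (∑ W ∈ U.powerset, prob pr (coreLevel arcs s U W) *
            chainMix ∅ ent' (pr (c a')) (chainC pr arcs s t U ent' a' a) (chainD pr arcs s t U ent' a' a) W *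
            (if m₂ ∈ W then (1 : R) else 0)) *
          (∑ W ∈ U.powerset, prob pr (coreLevel arcs s U W) *
            chainMix ∅ ent' (pr (c a')) (chainC pr arcs s t U ent' a' a) (chainD' pr arcs s t U ent' a' a w) W *
            (if m₁ ∈ W then (1 : R) else 0))
        + (∑ W ∈ U.powerset, prob pr (coreLevel arcs s U W) *
            chainMix ∅ ent' (pr (c a')) (chainC pr arcs s t U ent' a' a) (chainD pr arcs s t U ent' a' a) W *
            (if m₁ ∈ W then (1 : R) else 0)) *
          (∑ W ∈ U.powerset, prob pr (coreLevel arcs s U W) *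
            chainMix ∅ ent' (pr (c a')) (chainC pr arcs s t U ent' a' a) (chainD pr arcs s t U ent' a' a) W *
            (if m₂ ∈ W then (1 : R) else 0)) *
          (∑ W ∈ U.powerset, prob pr (coreLevel arcs s U W) *
            chainMix ∅ ent' (pr (c a')) (chainC pr arcs s t U ent' a' a) (chainD' pr arcs s t U ent' a' a w) W)) :
    DARC pr arcs s {t} m₁ m₂ a w := by
  have hC := h.closedInCoreU
  have ha'U : a' ∉ U := h'.a_notin
  have haU' : a ∉ insert a' U := h.a_notin
  have hm₁a : m₁ ≠ a := fun e => haU' (e ▸ Finset.mem_insert_of_mem hm₁)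
  have hm₂a : m₂ ≠ a := fun e => haU' (e ▸ Finset.mem_insert_of_mem hm₂)
  have hm₁a' : m₁ ≠ a' := fun e => ha'U (e ▸ hm₁)
  have hm₂a' : m₂ ≠ a' := fun e => ha'U (e ▸ hm₂)
  have hm₁C : m₁ ∈ insert a (insert a' U) :=
    Finset.mem_insert_of_mem (Finset.mem_insert_of_mem hm₁)
  have hm₂C : m₂ ∈ insert a (insert a' U) :=
    Finset.mem_insert_of_mem (Finset.mem_insert_of_mem hm₂)
  have haC : a ∈ insert a (insert a' U) := Finset.mem_insert_self _ _
  unfold DARC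
  rw [hC.phiC_gate_eq pr hS htC hts hm₁C hm₂C haC hws hwC]
  have hm1 : ∀ W : Finset V, (fun _ : Finset V => (1 : R)) (insert a W) = (fun _ => (1 : R)) W :=
    fun _ => rfl
  have hm1' : ∀ W : Finset V, (fun _ : Finset V => (1 : R)) (insert a' W) = (fun _ => (1 : R)) W :=
    fun _ => rfl
  have hmp : ∀ W : Finset V, (fun W : Finset V => if m₁ ∈ W then (1 : R) else 0) (insert a W) =
      (fun W : Finset V => if m₁ ∈ W then (1 : R) else 0) W := fun W => by
    simp only [Finset.mem_insert, hm₁a, false_or]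
  have hmp' : ∀ W : Finset V, (fun W : Finset V => if m₁ ∈ W then (1 : R) else 0) (insert a' W) =
      (fun W : Finset V => if m₁ ∈ W then (1 : R) else 0) W := fun W => by
    simp only [Finset.mem_insert, hm₁a', false_or]
  have hmq : ∀ W : Finset V, (fun W : Finset V => if m₂ ∈ W then (1 : R) else 0) (insert a W) =
      (fun W : Finset V => if m₂ ∈ W then (1 : R) else 0) W := fun W => by
    simp only [Finset.mem_insert, hm₂a, false_or]
  have hmq' : ∀ W : Finset V, (fun W : Finset V => if m₂ ∈ W then (1 : R) else 0) (insert a' W) =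
      (fun W : Finset V => if m₂ ∈ W then (1 : R) else 0) W := fun W => by
    simp only [Finset.mem_insert, hm₂a', false_or]
  have hmpq : ∀ W : Finset V,
      (fun W : Finset V => (if m₁ ∈ W then (1 : R) else 0) * (if m₂ ∈ W then (1 : R) else 0))
        (insert a W) =
      (fun W : Finset V => (if m₁ ∈ W then (1 : R) else 0) * (if m₂ ∈ W then (1 : R) else 0)) W :=
    fun W => by simp only [Finset.mem_insert, hm₁a, hm₂a, false_or]
  have hmpq' : ∀ W : Finset V,
      (fun W : Finset V => (if m₁ ∈ W then (1 : R) else 0) * (if m₂ ∈ W then (1 : R) else 0))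
        (insert a' W) =
      (fun W : Finset V => (if m₁ ∈ W then (1 : R) else 0) * (if m₂ ∈ W then (1 : R) else 0)) W :=
    fun W => by simp only [Finset.mem_insert, hm₁a', hm₂a', false_or]
  have eΛ := h.sum_R_eq pr t (fun _ => (1 : R)) hm1
  have eFa := h.sum_R_eq pr t (fun W => if m₁ ∈ W then (1 : R) else 0) hmp
  have eFb := h.sum_R_eq pr t (fun W => if m₂ ∈ W then (1 : R) else 0) hmq
  have eM := h.sum_G_eq (w := w) pr t (fun _ => (1 : R)) hm1
  have eX := h.sum_G_eq (w := w) pr t (fun W => if m₁ ∈ W then (1 : R) else 0) hmp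
  have eY := h.sum_G_eq (w := w) pr t (fun W => if m₂ ∈ W then (1 : R) else 0) hmq
  have eXY := h.sum_G_eq (w := w) pr t
    (fun W => (if m₁ ∈ W then (1 : R) else 0) * (if m₂ ∈ W then (1 : R) else 0)) hmpq
  simp only [mul_one] at eΛ eM
  rw [eΛ, eFa, eFb, eM, eX, eY, eXY]
  set A : Finset V → R := fun X => prob pr (coreAvoidEvent arcs s t (insert a (insert a' U)) X)
    with hAdef
  have fΛ := h'.sum_gen pr (rValK A pr {a'} c a) (fun _ => (1 : R)) hm1'
  have fFa := h'.sum_gen pr (rValK A pr {a'} c a) (fun W => if m₁ ∈ W then (1 : R) else 0) hmp'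
  have fFb := h'.sum_gen pr (rValK A pr {a'} c a) (fun W => if m₂ ∈ W then (1 : R) else 0) hmq'
  have fM := h'.sum_gen pr (gValK A pr {a'} c a w) (fun _ => (1 : R)) hm1'
  have fX := h'.sum_gen pr (gValK A pr {a'} c a w) (fun W => if m₁ ∈ W then (1 : R) else 0) hmp'
  have fY := h'.sum_gen pr (gValK A pr {a'} c a w) (fun W => if m₂ ∈ W then (1 : R) else 0) hmq'
  have fXY := h'.sum_gen pr (gValK A pr {a'} c a w)
    (fun W => (if m₁ ∈ W then (1 : R) else 0) * (if m₂ ∈ W then (1 : R) else 0)) hmpq'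
  simp only [mul_one] at fΛ fM
  rw [fΛ, fFa, fFb, fM, fX, fY, fXY]
  -- the chain data
  have ha'W : ∀ W ∈ U.powerset, a' ∉ W := fun W hW hx => ha'U (Finset.mem_powerset.1 hW hx)
  have eR : ∀ m : Finset V → R,
      ∑ W ∈ U.powerset, prob pr (coreLevel arcs s U W) *
        (tailWtK pr ent' c' W * rValK A pr {a'} c a W +
          (1 - tailWtK pr ent' c' W) * rValK A pr {a'} c a (W ∪ {a'})) * m W =
      ∑ W ∈ U.powerset, prob pr (coreLevel arcs s U W) *
        chainMix ∅ ent' (pr (c a')) (fun X => A (chainPhi ent' a' X))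
          (fun X => A (chainPhi ent' a' X ∪ {a})) W * m W :=
    fun m => Finset.sum_congr rfl fun W hW => by
      rw [rValK_sure_chain_eq (c := c) (a := a) A pr hsure' W (ha'W W hW)]
  have eR0 : ∑ W ∈ U.powerset, prob pr (coreLevel arcs s U W) *
        (tailWtK pr ent' c' W * rValK A pr {a'} c a W +
          (1 - tailWtK pr ent' c' W) * rValK A pr {a'} c a (W ∪ {a'})) =
      ∑ W ∈ U.powerset, prob pr (coreLevel arcs s U W) *
        chainMix ∅ ent' (pr (c a')) (fun X => A (chainPhi ent' a' X))
          (fun X => A (chainPhi ent' a' X ∪ {a})) W :=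
    Finset.sum_congr rfl fun W hW => by
      rw [rValK_sure_chain_eq (c := c) (a := a) A pr hsure' W (ha'W W hW)]
  have eG : ∀ m : Finset V → R,
      ∑ W ∈ U.powerset, prob pr (coreLevel arcs s U W) *
        (tailWtK pr ent' c' W * gValK A pr {a'} c a w W +
          (1 - tailWtK pr ent' c' W) * gValK A pr {a'} c a w (W ∪ {a'})) * m W =
      ∑ W ∈ U.powerset, prob pr (coreLevel arcs s U W) *
        chainMix ∅ ent' (pr (c a')) (fun X => A (chainPhi ent' a' X))
          (fun X => A (chainPhi ent' a' X ∪ {a, w})) W * m W :=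
    fun m => Finset.sum_congr rfl fun W hW => by
      rw [gValK_sure_chain_eq (c := c) (a := a) (w := w) A pr hsure' W (ha'W W hW)]
  have eG0 : ∑ W ∈ U.powerset, prob pr (coreLevel arcs s U W) *
        (tailWtK pr ent' c' W * gValK A pr {a'} c a w W +
          (1 - tailWtK pr ent' c' W) * gValK A pr {a'} c a w (W ∪ {a'})) =
      ∑ W ∈ U.powerset, prob pr (coreLevel arcs s U W) *
        chainMix ∅ ent' (pr (c a')) (fun X => A (chainPhi ent' a' X))
          (fun X => A (chainPhi ent' a' X ∪ {a, w})) W :=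
    Finset.sum_congr rfl fun W hW => by
      rw [gValK_sure_chain_eq (c := c) (a := a) (w := w) A pr hsure' W (ha'W W hW)]
  rw [eR0, eG0, eR (fun W => if m₁ ∈ W then (1 : R) else 0),
    eR (fun W => if m₂ ∈ W then (1 : R) else 0), eG (fun W => if m₁ ∈ W then (1 : R) else 0),
    eG (fun W => if m₂ ∈ W then (1 : R) else 0),
    eG (fun W => (if m₁ ∈ W then (1 : R) else 0) * (if m₂ ∈ W then (1 : R) else 0))]
  exact hF

end ChainReduction

end Summit.Ventures.PercRepro2.Coin
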